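import Summits.Ventures.PercRepro.C026Unicyclic

/-!
# Counting in a forest: the handshake and `|F| + 1 ≤ |W|` (p6, gen 12)

Two counting lemmas for THEOREM U (`proofs/P6-unicyclic.md` §2):

* **handshake** (`sum_edgeDeg`): without loops, `Σ_v deg v = 2 |E|`;
* **the forest bound** (`card_add_one_le_card_suppOn`): if a set `F` of edges is
  acyclic — with the edges of `F` open and one of them closed, its endpoints are not joined
  (`AcyclicSet`) — then `|F| + 1 ≤ |W_F|`, `W_F` the vertices carrying an `F`-edge.  Proof by an
  injection: for `e ∈ F` let `r e` be the chosen representative of the component of `e` (all of `F`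
  open) and `child e` the endpoint of `e` NOT joined to `r e` once `e` is closed (exactly one endpoint
  is, by acyclicity); `child` is injective (`conn_update_true_iff` on the two closed edges) and never
  a representative, so `F` injects into `W_F` minus the representatives.
-/

namespace PercRepro

open Finset

namespace MultiGraph

section Handshake

variable {V E : Type*} [Fintype V] [Fintype E] [DecidableEq V] (G : MultiGraph V E)

/-- The degree of a vertex: the edges having it as an endpoint (a loop counts once). -/
def edgeDeg (v : V) : ℕ := (univ.filter fun e => G.fst e = v ∨ G.snd e = v).card

/-- **Handshake** without loops: `Σ_v deg v = 2 |E|`. -/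
theorem sum_edgeDeg (hl : ∀ e, G.fst e ≠ G.snd e) :
    ∑ v, G.edgeDeg v = 2 * Fintype.card E := by
  unfold edgeDeg
  simp only [Finset.card_filter]
  rw [Finset.sum_comm]
  rw [Finset.card_univ.symm, Finset.card_eq_sum_ones, Finset.mul_sum]
  refine Finset.sum_congr rfl fun e _ => ?_
  rw [← Finset.card_filter]
  have : (univ.filter fun v => G.fst e = v ∨ G.snd e = v) = {G.fst e, G.snd e} := by
    ext v
    simp only [Finset.mem_filter, Finset.mem_univ, true_and, Finset.mem_insert,
      Finset.mem_singleton]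
    constructor
    · rintro (h | h)
      · exact Or.inl h.symm
      · exact Or.inr h.symm
    · rintro (h | h)
      · exact Or.inl h.symm
      · exact Or.inr h.symm
  rw [this, Finset.card_pair (hl e)]
  simp

end Handshake

section ForestBound

variable {V E : Type*} [Fintype V] [Fintype E] [DecidableEq V] [DecidableEq E]
  (G : MultiGraph V E)

omit [Fintype V] [Fintype E] [DecidableEq V] in
/-- The configuration with exactly the edges of `F` open. -/
def openOn (F : Finset E) : Config E := fun e => decide (e ∈ F)

/-- **`F` is acyclic**: with the edges of `F` open and one of them closed, its endpoints are not
joined. -/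
def AcyclicSet (F : Finset E) : Prop :=
  ∀ e ∈ F, ¬ G.Conn (Function.update (openOn F) e false) (G.fst e) (G.snd e)

/-- The vertices carrying an `F`-edge. -/
def suppOn (F : Finset E) : Finset V := univ.filter fun v => ∃ e ∈ F, G.fst e = v ∨ G.snd e = v

variable {G}

omit [Fintype V] [Fintype E] [DecidableEq V] in
/-- Opening back the closed edge restores `openOn F`. -/
theorem update_update_openOn {F : Finset E} {e : E} (he : e ∈ F) :
    Function.update (Function.update (openOn F) e false) e true = openOn F := by
  rw [Function.update_idem, Function.update_eq_self_iff]
  simp [openOn, he]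

omit [Fintype V] [Fintype E] [DecidableEq V] in
/-- An acyclic `F` has no loops. -/
theorem AcyclicSet.fst_ne_snd {F : Finset E} (h : G.AcyclicSet F) {e : E} (he : e ∈ F) :
    G.fst e ≠ G.snd e := fun heq => h e he (heq ▸ Conn.refl G _ _)

omit [DecidableEq V] in
/-- The representative of the component of `v` with `F` open. -/
noncomputable def repOn (F : Finset E) (v : V) : V :=
  (Quotient.mk (G.connSetoid (openOn F)) v).out

omit [Fintype V] [Fintype E] [DecidableEq V] in
/-- The representative is joined to `v`. -/
theorem conn_rep (F : Finset E) (v : V) : G.Conn (openOn F) (G.repOn F v) v :=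
  Quotient.exact (s := G.connSetoid (openOn F)) (Quotient.out_eq _)

omit [Fintype V] [Fintype E] [DecidableEq V] in
/-- Joined vertices have the same representative. -/
theorem rep_eq_of_conn {F : Finset E} {v w : V} (h : G.Conn (openOn F) v w) :
    G.repOn F v = G.repOn F w := by
  unfold repOn
  congr 1
  exact Quotient.sound h

open Classical in
/-- **The child of an edge**: the endpoint of `e` not joined to the representative once `e` is
closed (the other endpoint is joined, by `conn_update_true_iff`). -/
noncomputable def child (F : Finset E) (e : E) : V :=
  if G.Conn (Function.update (openOn F) e false) (G.repOn F (G.fst e)) (G.fst e) then G.snd e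
  else G.fst e

/-- The child is an endpoint of its edge. -/
theorem child_mem {F : Finset E} (e : E) : G.child F e = G.fst e ∨ G.child F e = G.snd e := by
  unfold child
  split_ifs
  · exact Or.inr rfl
  · exact Or.inl rfl

/-- **The child is not joined to the representative** once its edge is closed (acyclicity). -/
theorem not_conn_child {F : Finset E} (hF : G.AcyclicSet F) {e : E} (he : e ∈ F) :
    ¬ G.Conn (Function.update (openOn F) e false) (G.repOn F (G.fst e)) (G.child F e) := by
  unfold child
  split_ifs with h
  · intro h'
    exact hF e he (h.symm.trans h')
  · exact h

omit [Fintype V] [Fintype E] [DecidableEq V] in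
/-- **One endpoint is joined to the representative** once the edge is closed. -/
theorem conn_rep_parent {F : Finset E} {e : E} (he : e ∈ F) :
    G.Conn (Function.update (openOn F) e false) (G.repOn F (G.fst e)) (G.fst e) ∨
      G.Conn (Function.update (openOn F) e false) (G.repOn F (G.fst e)) (G.snd e) := by
  have hr := G.conn_rep F (G.fst e)
  rw [← update_update_openOn he, G.conn_update_true_iff] at hr
  rcases hr with h | ⟨h, -⟩ | ⟨h, -⟩
  · exact Or.inl h
  · exact Or.inl h
  · exact Or.inr h

/-- The child is never the representative of its component. -/
theorem child_ne_rep {F : Finset E} (hF : G.AcyclicSet F) {e : E} (he : e ∈ F) :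
    G.child F e ≠ G.repOn F (G.fst e) := fun h =>
  not_conn_child hF he (h ▸ Conn.refl G _ _)

/-- The representative of the child's edge is the representative of the child. -/
theorem rep_child {F : Finset E} {e : E} (he : e ∈ F) : G.repOn F (G.child F e) = G.repOn F (G.fst e) := by
  rcases child_mem (G := G) (F := F) e with h | h
  · rw [h]
  · rw [h]
    refine (rep_eq_of_conn ?_).symm
    exact Conn.of_openAdj ⟨e, by simp [openOn, he], Or.inl ⟨rfl, rfl⟩⟩

open Classical in
/-- **The parent endpoint**: the one joined to the representative once the edge is closed. -/
noncomputable def parent (F : Finset E) (e : E) : V :=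
  if G.Conn (Function.update (openOn F) e false) (G.repOn F (G.fst e)) (G.fst e) then G.fst e
  else G.snd e

/-- `child` and `parent` are the two endpoints. -/
theorem child_parent {F : Finset E} (e : E) :
    (G.child F e = G.snd e ∧ G.parent F e = G.fst e) ∨
      (G.child F e = G.fst e ∧ G.parent F e = G.snd e) := by
  unfold child parent
  split_ifs
  · exact Or.inl ⟨rfl, rfl⟩
  · exact Or.inr ⟨rfl, rfl⟩

/-- The parent endpoint is joined to the representative once the edge is closed. -/
theorem conn_rep_parent' {F : Finset E} {e : E} (he : e ∈ F) :
    G.Conn (Function.update (openOn F) e false) (G.repOn F (G.fst e)) (G.parent F e) := by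
  unfold parent
  split_ifs with h
  · exact h
  · rcases conn_rep_parent (G := G) he with h' | h'
    · exact absurd h' h
    · exact h'

omit [Fintype V] [Fintype E] [DecidableEq V] in
/-- Opening an edge joins `r` to `v` only through `v` or through an endpoint. -/
theorem conn_update_true_imp {ω : Config E} {f : E} {r v : V}
    (h : G.Conn (Function.update ω f true) r v) :
    G.Conn ω r v ∨ G.Conn ω r (G.fst f) ∨ G.Conn ω r (G.snd f) := by
  rw [G.conn_update_true_iff] at h
  rcases h with h | ⟨h, -⟩ | ⟨h, -⟩
  · exact Or.inl h
  · exact Or.inr (Or.inl h)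
  · exact Or.inr (Or.inr h)

omit [Fintype V] [Fintype E] [DecidableEq V] in
/-- Closing an edge destroys no non-connection. -/
theorem not_conn_of_not_conn_update {ω : Config E} {f : E} {r v : V}
    (h : ¬ G.Conn (Function.update ω f true) r v) : ¬ G.Conn ω r v := fun h' =>
  h (Conn.mono (fun e => by by_cases hef : e = f <;> simp [hef]) h')

omit [Fintype V] [Fintype E] [DecidableEq V] [DecidableEq E] in
/-- The endpoints of an open edge are joined. -/
theorem conn_ends_of_open {ω : Config E} {f : E} (hf : ω f = true) :
    G.Conn ω (G.fst f) (G.snd f) :=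
  Conn.of_openAdj ⟨f, hf, Or.inl ⟨rfl, rfl⟩⟩

/-- **The child map is injective on `F`.** -/
theorem child_injOn {F : Finset E} (hF : G.AcyclicSet F) : Set.InjOn (G.child F) F := by
  intro e he e' he' hch
  by_contra hne
  set w := G.child F e with hw
  have hrep : G.repOn F (G.fst e') = G.repOn F (G.fst e) := by
    rw [← rep_child he, ← rep_child he', ← hch]
  set r := G.repOn F (G.fst e) with hr
  -- the two closed-edge configurations over the both-closed one
  set ω₀ : Config E := Function.update (Function.update (openOn F) e false) e' false with hω₀
  have hωe : Function.update (openOn F) e false = Function.update ω₀ e' true := by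
    funext f
    by_cases hf : f = e'
    · subst hf
      simp [hω₀, Function.update_of_ne (Ne.symm hne), openOn, Finset.mem_coe.mp he']
    · by_cases hf' : f = e
      · subst hf'
        simp [hω₀, Function.update_of_ne hne]
      · simp [hω₀, Function.update_of_ne hf, Function.update_of_ne hf']
  have hωe' : Function.update (openOn F) e' false = Function.update ω₀ e true := by
    funext f
    by_cases hf : f = e
    · subst hf
      simp [hω₀, Function.update_of_ne hne, openOn, Finset.mem_coe.mp he]
    · by_cases hf' : f = e'
      · subst hf'
        simp [hω₀, Function.update_of_ne (Ne.symm hne)]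
      · simp [hω₀, Function.update_of_ne hf, Function.update_of_ne hf']
  -- (A) the child is not joined to `r` with `e` closed; (B) likewise with `e'` closed
  have hA : ¬ G.Conn (Function.update ω₀ e' true) r w := by
    rw [← hωe]
    exact not_conn_child hF he
  have hB : ¬ G.Conn (Function.update ω₀ e true) r w := by
    rw [← hωe', ← hrep, hch]
    exact not_conn_child hF he'
  -- (D) the other endpoint of `e'` is joined to `r` with `e'` closed
  have hD : G.Conn (Function.update ω₀ e true) r (G.parent F e') := by
    rw [← hωe', ← hrep]
    exact conn_rep_parent' he'
  have h0w : ¬ G.Conn ω₀ r w := not_conn_of_not_conn_update hA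
  -- `r` is not joined to the other endpoint of `e'` in `ω₀` (else to `w` through `e'`)
  have h0e' : ¬ G.Conn ω₀ r (G.parent F e') := by
    intro h
    apply hA
    have hadj : G.Conn (Function.update ω₀ e' true) (G.parent F e') (G.child F e') := by
      have hends := G.conn_ends_of_open (ω := Function.update ω₀ e' true) (f := e')
        (Function.update_self _ _ _)
      rcases child_parent (G := G) (F := F) e' with ⟨hc, ho⟩ | ⟨hc, ho⟩
      · rw [ho, hc]; exact hends
      · rw [ho, hc]; exact hends.symm
    rw [← hch] at hadj
    exact (Conn.mono (fun x => by by_cases hx : x = e' <;> simp [hx]) h).trans hadj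
  -- `r` is not joined to the other endpoint of `e` in `ω₀` (else to `w` through `e`)
  have h0e : ¬ G.Conn ω₀ r (G.parent F e) := by
    intro h
    apply hB
    have hadj : G.Conn (Function.update ω₀ e true) (G.parent F e) (G.child F e) := by
      have hends := G.conn_ends_of_open (ω := Function.update ω₀ e true) (f := e)
        (Function.update_self _ _ _)
      rcases child_parent (G := G) (F := F) e with ⟨hc, ho⟩ | ⟨hc, ho⟩
      · rw [ho, hc]; exact hends
      · rw [ho, hc]; exact hends.symm
    rw [← hw] at hadj
    exact (Conn.mono (fun x => by by_cases hx : x = e <;> simp [hx]) h).trans hadj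
  -- (D) through `e`: `r` reaches `parent e'` in `ω₀`, or an endpoint of `e` — all excluded
  rcases conn_update_true_imp (G := G) hD with h | h | h
  · exact h0e' h
  · rcases child_parent (G := G) (F := F) e with ⟨hc, ho⟩ | ⟨hc, ho⟩
    · rw [← ho] at h; exact h0e h
    · rw [← hc, ← hw] at h; exact h0w h
  · rcases child_parent (G := G) (F := F) e with ⟨hc, ho⟩ | ⟨hc, ho⟩
    · rw [← hc, ← hw] at h; exact h0w h
    · rw [← ho] at h; exact h0e h

/-- The child carries an `F`-edge. -/
theorem child_mem_suppOn {F : Finset E} {e : E} (he : e ∈ F) : G.child F e ∈ G.suppOn F := by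
  simp only [suppOn, Finset.mem_filter, Finset.mem_univ, true_and]
  rcases child_mem (G := G) (F := F) e with h | h
  · exact ⟨e, he, Or.inl h.symm⟩
  · exact ⟨e, he, Or.inr h.symm⟩

omit [Fintype E] in
/-- The representative of a vertex carrying an `F`-edge carries an `F`-edge. -/
theorem rep_mem_suppOn {F : Finset E} {e : E} (he : e ∈ F) : G.repOn F (G.fst e) ∈ G.suppOn F := by
  simp only [suppOn, Finset.mem_filter, Finset.mem_univ, true_and]
  have hr := G.conn_rep F (G.fst e)
  by_cases hrv : G.repOn F (G.fst e) = G.fst e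
  · exact ⟨e, he, Or.inl hrv.symm⟩
  · -- a walk from `r ≠ fst e` to `fst e` starts with an open edge at `r`
    obtain ⟨f, hf, hend⟩ : ∃ f, openOn F f = true ∧
        (G.fst f = G.repOn F (G.fst e) ∨ G.snd f = G.repOn F (G.fst e)) := by
      refine Conn.induction (motive := fun v => v ≠ G.repOn F (G.fst e) → ∃ f, openOn F f = true ∧
        (G.fst f = G.repOn F (G.fst e) ∨ G.snd f = G.repOn F (G.fst e))) (fun h => absurd rfl h) ?_ hr
        (Ne.symm hrv)
      intro x y hx hxy ih _
      by_cases hxr : x = G.repOn F (G.fst e)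
      · obtain ⟨f, hf, hend⟩ := hxy
        refine ⟨f, hf, ?_⟩
        rcases hend with ⟨h1, _⟩ | ⟨_, h2⟩
        · exact Or.inl (h1.trans hxr)
        · exact Or.inr (h2.trans hxr)
      · exact ih hxr
    have hfF : f ∈ F := by simpa [openOn] using hf
    exact ⟨f, hfF, hend⟩

omit [Fintype V] [Fintype E] [DecidableEq V] in
/-- The representative of a representative is itself. -/
theorem rep_rep (F : Finset E) (v : V) : G.repOn F (G.repOn F v) = G.repOn F v :=
  rep_eq_of_conn (G.conn_rep F v)

/-- **The forest bound**: an acyclic set of edges has fewer edges than vertices —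
`|F| + 1 ≤ |W_F|`. -/
theorem card_add_one_le_card_suppOn {F : Finset E} (hF : G.AcyclicSet F) (hne : F.Nonempty) :
    F.card + 1 ≤ (G.suppOn F).card := by
  classical
  set R : Finset V := F.image fun e => G.repOn F (G.fst e) with hR
  have hRsub : R ⊆ G.suppOn F := by
    intro r hr
    obtain ⟨e, he, rfl⟩ := Finset.mem_image.mp hr
    exact rep_mem_suppOn he
  have hRne : R.Nonempty := hne.image _
  have himg : F.image (G.child F) ⊆ G.suppOn F \ R := by
    intro w hw
    obtain ⟨e, he, rfl⟩ := Finset.mem_image.mp hw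
    refine Finset.mem_sdiff.mpr ⟨child_mem_suppOn he, fun hw' => ?_⟩
    obtain ⟨e', _, hre⟩ := Finset.mem_image.mp hw'
    apply child_ne_rep hF he
    rw [← rep_child he, ← hre, rep_rep]
  have h1 : F.card = (F.image (G.child F)).card :=
    (Finset.card_image_of_injOn (child_injOn hF)).symm
  have h2 := Finset.card_le_card himg
  have h3 : (G.suppOn F \ R).card = (G.suppOn F).card - R.card := Finset.card_sdiff_of_subset hRsub
  have h4 := Finset.card_pos.mpr hRne
  have h5 := Finset.card_le_card hRsub
  omega

end ForestBound

end MultiGraph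

end PercRepro
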